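import Mathlib
import Summits.CriticalPhenomena.CardyFormulaZ2.Theses.CardyMagicRigidity
import Summits.CriticalPhenomena.CardyFormulaZ2.Theorems.CardyMagicRigidityDefs
import Summits.CriticalPhenomena.CardyFormulaZ2.Theorems.CardyMagicRigidityPositiveConeDefs
import Summits.CriticalPhenomena.CardyFormulaZ2.Theorems.CardyMagicRigidityNestingRigidityCloudAdmissibility
import Summits.CriticalPhenomena.CardyFormulaZ2.Theorems.CardyMagicRigidityNestingRigidityCloudEnergy
import Summits.CriticalPhenomena.CardyFormulaZ2.Theorems.CardyMagicRigidityNestingRigidityTiltUniqueness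
import Summits.CriticalPhenomena.CardyFormulaZ2.Theorems.CardyMagicRigidityNestingRigidityTowerPressureSanity
import Summits.CriticalPhenomena.CardyFormulaZ2.Theorems.CardyMagicRigidityNestingRigidityPressureCalibration
import Summits.CriticalPhenomena.CardyFormulaZ2.Theorems.CardyMagicRigidityNestingRigidityConeLever
import Summits.CriticalPhenomena.CardyFormulaZ2.Theorems.CardyMagicRigidityNestingRigidityConeTiltLoopSide
import Summits.CriticalPhenomena.CardyFormulaZ2.Theorems.CardyMagicRigidityNestingRigidityStaircaseCloud
import Summits.CriticalPhenomena.CardyFormulaZ2.Theorems.CardyMagicRigidityNestingRigidityFusionReduction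
import Summits.CriticalPhenomena.CardyFormulaZ2.Theorems.CardyMagicRigidityNestingRigidityTransferReduction
import Summits.CriticalPhenomena.CardyFormulaZ2.Theorems.CardyMagicRigidityNestingRigidityTransferReconstruction
import Summits.CriticalPhenomena.CardyFormulaZ2.Theorems.CardyMagicRigidityNestingRigidityTransferRigidity
import Summits.CriticalPhenomena.CardyFormulaZ2.Theorems.CardyMagicRigidityNestingRigidityTowerIndependence
import Summits.CriticalPhenomena.CardyFormulaZ2.Theorems.CardyMagicRigidityNestingRigidityUVLinearisation
import Summits.CriticalPhenomena.CardyFormulaZ2.Theorems.CardyMagicRigidityNestingRigidityGapCrossing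
import Summits.CriticalPhenomena.CardyFormulaZ2.Theorems.CardyMagicRigidityNestingRigidityGapTower
import Summits.CriticalPhenomena.CardyFormulaZ2.Theorems.CardyMagicRigidityNestingRigidityFusionCloudLoopSide
import Summits.CriticalPhenomena.CardyFormulaZ2.Theorems.CardyMagicRigidityNestingRigidityFusionCloudCarriers
import Summits.CriticalPhenomena.CardyFormulaZ2.Theorems.CardyMagicRigidityNestingRigidityRegularNotRigid
import Summits.CriticalPhenomena.CardyFormulaZ2.Theorems.CardyMagicRigidityNestingRigidityStaircasePathwise
import Summits.CriticalPhenomena.CardyFormulaZ2.Theorems.CardyMagicRigidityNestingRigidityStaircaseGapTowers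
import Summits.CriticalPhenomena.CardyFormulaZ2.Theorems.CardyMagicRigidityNestingRigidityStaircaseReduction
import Summits.CriticalPhenomena.CardyFormulaZ2.Theorems.CardyMagicRigidityNestingRigidityUVTiltTransferReduction
import Summits.CriticalPhenomena.CardyFormulaZ2.Theorems.CardyMagicRigidityNestingRigidityStaircaseIntegrability
import Summits.CriticalPhenomena.CardyFormulaZ2.Theorems.CardyMagicRigidityNestingRigidityStaircaseTowerProduct
import Summits.CriticalPhenomena.CardyFormulaZ2.Theorems.CardyMagicRigidityNestingRigidityStaircaseGoodEvent
import Summits.CriticalPhenomena.CardyFormulaZ2.Theorems.CardyMagicRigidityNestingRigidityStaircaseFirstMoment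
import Summits.CriticalPhenomena.CardyFormulaZ2.Theorems.CardyMagicRigidityNestingRigidityFusionSqueeze
import Summits.CriticalPhenomena.CardyFormulaZ2.Theorems.CardyMagicRigidityNestingRigidityFusionRidge
import Summits.CriticalPhenomena.CardyFormulaZ2.Theorems.CardyMagicRigidityNestingRigidityTransferSimpleLoops
import Summits.CriticalPhenomena.CardyFormulaZ2.Theorems.CardyMagicRigidityNestingRigidityLoopCrossCount
import Summits.CriticalPhenomena.CardyFormulaZ2.Theorems.CardyMagicRigidityNestingRigidityBigLoopsFirstMoment
import Summits.CriticalPhenomena.CardyFormulaZ2.Theorems.CardyMagicRigidityNestingRigiditySmearedCentringZ2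
import Literature.Probability.RandomPlanarGeometry.NestingTransform
import Literature.Probability.Percolation.FullPlaneCNL
import Literature.Barriers.CriticalPhenomena.NestingTransformBlindness

/-!
# Line `ring-cloud-tomography` — skeleton r6 (seat c3-0: r5 + wave 1) for crux `NestingRigidity` (stmt-CriticalPhenomena-4835)

Route `CardyMagicRigidity` (sub-problem `CriticalPhenomena/CardyFormulaZ2`). The crux, by name:
`Summit.CriticalPhenomena.CardyFormulaZ2.Theses.CardyMagicRigidity.NestingRigidity ≡
MagicFormulaZ2 → MagicFormulaT → LoopLimitZ2EqT`.

THE LINE (card `Ideas/ring-cloud-tomography.md`, line card `Lines/ring-cloud-tomography.md`): test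
functions = CLOUDS (disc bumps + ring charges in mean-value position), whose Gaussian exponent is explicit
(`CloudCalculus` = S1a `stub_cloudAdmissibility` p72339 ∧ S1b `stub_cloudEnergy` p74556, LANDED). On the
loop side a cloud writes a positive weight profile on the tower of loops nested around a point; the
n = 1 layer reads the tower PRESSURE; the n ≥ 2 layers (tower LAWS, pattern LAWS) are the crux's open
content; `Transfer` turns equal pattern statistics into `d_CN → 0`.

## Lead reshape r3 (seat c2-0, 2026-08-16) — the n = 1 layer re-cut along the STAIRCASE device

Seat -0 (r2) left S2 `TowerPressureFamily` / S3 `ChargeQuantisation` blocked ("one-arm exponent inside the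
family; on ℤ² open").  They are re-cut into three stubs over the sibling line's n = 1 vocabulary
(`ConeTiltLaw`, `NestingDensity`, `meanTower`, `magicWeight`, `beta`, `nuSix` of
`Theorems/CardyMagicRigidityPositiveConeDefs.lean`, p96037 — imported, nothing re-declared):

* R1 `stub_coneTilt` (L): `E.CloudLaw → ConeTiltLaw E` for both lattice ensembles — the single-radius cloud
  identity at charges `t ∈ (−π/6, π/6)` read through RSW separation of scales (all loop weights `≥ 0`).
* R2 `stub_partnerTilt` (L, NEW): the same sandwich at the PARTNER charges `t' ∈ (−5π/6, −π/2)`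
  (`w(t') = w(−2π/3 − t')`, `magicWeight_doubling`), realised by STAIRCASE clouds: bump charge `t'` on
  `B(0,r)`, `k = ⌈|t'|/(π/6)⌉` rings of charge `≤ π/6` each at scales `r ≪ L₁ < M₁ ≪ L₂ < M₂ ≪ ⋯`.  Every
  band charge lies in `[−5π/6, 0]`, every single-carrier bite in `[−5π/6, π/6]` (`w ≥ 0` exactly on
  `[−5π/6, π/6]`; a loop whose interior contains a whole ring contains its hole, hence the bump), so the
  only signed weights sit on loops biting two rings `j₁ < j₂` without surrounding the bump — their trace
  crosses the gap annulus `A(M_{j₁}, L_{j₂})`, an interface (polychromatic two-arm) crossing of a WIDE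
  annulus: probability `≤ C (M_{j₁}/L_{j₂})^c` (RSW, both lattices), an `r`-independent small constant, so
  the signed outer factor keeps a positive pairing against every non-negative inner functional and the
  band-0 rate in `r` is read exactly as in R1.  This is the device that un-blocks S3: DKLM announce the same
  consequence for their companion [alpha1] (arXiv:2603.06268 §3.1 p. 13: one-arm exponent of FK(q),
  q ∈ [1,4], on ℤ², "underpinned" by Cor. 10).
* R3 `stub_pressureCalibration` (M, PROVABLE NOW, pure real analysis): for `E ∈ latticeEnsembles`,
  `ConeTiltLaw E → PartnerTiltLaw E → NestingDensity E ∧ E.HasTowerPressure e6 (Ioo 0 √3)`.  The partner identity at `t' = −2π/3` ALONE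
  (`w = 1`) gives `E_δ[N_0(r,1)] = (ν ± η) log(1/r)`, `ν = 2πβ/(3√3) = 1/(2π√3)` (`density_from_doubling`);
  the two readings of `E[w^N]` at `(t, −2π/3 − t)` give `log E[w(t)^N] = (βt² + t/2π ± O(η)) log r`, and
  `βt² + t/2π = e6 (w t)` (`calibrated_exponent_eq_magicExponent_six`, `e6_eq_pressureFamily`).
  (The old S2/S3 statements follow: `TowerPressureFamily` with `a = 1/2π`, `ChargeQuantisation`.)
* R4 `stub_towerTilt` (XL, LOAD-BEARING, lead): cloud laws + calibrated pressures + densities on BOTH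
  lattices ⇒ the positively tilted one-point tower moments merge (identities ⇒ LAWS: the crux content;
  DKLM's [alpha2] announces exponents and dimensions of subsequential limits, not the identification).
* S4b `stub_tiltUniqueness` LANDED (p75974, imported): tilted moments ⇒ `TowerStatisticsAgree`.
* R5 `stub_fusion : Fusion` (XL), R6 `stub_transfer : Transfer` (L–XL) — statements unchanged (Defs p71837).

`NestingRigidity_of : NestingRigidity` composes R1–R6 + the landed S1a/S1b/S4b BY NAME (kernel-checked; the
only sorries of the file are the six `stub_*` below).  Registration: `workitem stub-add` per stub (no
`skeleton check` sweep while the sibling leads -2 / c1-0 are live on this item).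

## Lead reshape r4 (seat c2-0, after wave 1, 2026-08-16T16:30Z)

Wave 1 (five workers): R3 `stub_pressureCalibration` LANDED (p106959).  R1 → loop side landed
(`…ConeTiltLoopSide` p109750: cone-cloud decomposition `A = w(t)^{N_0(r,1)} ∏ᶠ non-tower` on both lattices,
bite formula, cone positivity, tower-count super-additivity) and, with the sibling seat's `…ConeLever`
(p107226: `coneTiltLaw_of_cloudLaw : CloudLaw → UVDecoupling E → ConeTiltLaw E`), R1 = glue + the RSW
estimate `UVDecoupling E` ⇒ re-cut as **R1' `stub_uvDecoupling`**.  R2 → staircase core landed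
(`…StaircaseCloud` p110700: admissibility, phase formula, energy split `t² log r + C`, winding constancy, the
full bite CLASSIFICATION `nestingFactor_nonneg_or_cross`, and `Staircase.partnerTilt_of_decoupling`) ⇒ re-cut as
**R2' `stub_staircaseDecoupling`** (the staircase analogue of `UVDecoupling`, existential in the staircase).
R5 → `stub-misstated`: `TowerStatisticsAgree` (disc-centred windows) cannot carry the n = 1 off-centre layer
(event-level witness `towerCount_blind_to_offCentre_window` and the glue `fusion_of_tiltAgreement'`,
`nestingStatisticsAgree_one_of_oneDiscTilt` landed in `…FusionReduction` p111833) ⇒ R4 now ALSO outputs the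
all-window one-disc tilt agreement (**R4' `stub_towerTiltWide`**, lead) and R5 is re-cut as **R5'
`stub_fusionTilt`** (cloud laws + one-disc tilts ⇒ `TiltAgreementAt` at every admissible disc family; `Fusion`
then by the landed glue + the sibling's landed `stub_pgfUniqueness`).  R6 → glue `transfer_of_precompactness`
+ reconstruction groundwork landed (`…TransferReduction` p112841); ROUTE GAP recorded: `Regular` (sibling Defs)
does not make interior ↦ loop injective mod reversal across configurations (figure-eight lobe orientations;
retraced arcs pass `boundary` because `wind = 0` on the trace) — the reconstruction step needs single-signed
winding + canonical traversal (no triple points) on BOTH limits; `stub_transfer : Transfer` is kept whole.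

## Wave 2 (seat c2-0, 2026-08-16T16:50–19:10Z) — the RSW inputs isolated, the route gap proved

* R1': `…TowerIndependence` p116000 (cylinder property of tower counts on both lattices; independence across nested
  annuli; exact SUB-multiplicativity `towerMoment_le_mul`) and `…UVLinearisation` p116917
  (`uvDecoupling_of_tilted_moments`: `UVDecoupling E` ⇐ (L) one-sided tilted first-moment + Σθ² bound, (U) tilted
  exponential concentration — the two remaining RSW statements, verbatim in that theorem's hypotheses).
* R2': `…GapCrossing` p117337 (P{a loop meets closedBall x a and (ball x b)ᶜ} ≤ C (a/b)^c on BOTH lattices, from the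
  PROVED annulus-crossing bounds `annulusOpenCrossing_half_le_holds` / `tri_annulusCrossing_bound_holds`) and `…GapTower`
  p118151 (tilted rarity of gap-crossing loops); scratch `work/stubs/StaircaseReduction.lean` (729 lines, rc 0):
  `stub_staircaseDecoupling_of_inputs : (QU both lattices) → R2'` — to be split and landed (wave 3).
* R5': `…FusionCloudLoopSide` p119417 / `…FusionCloudCarriers` p119706 (multi-disc cloud: admissibility, bite formula,
  `A = ∏_S w_S^{N_S} · (touching factor)`, positivity range, touching-factor sandwich).  Finding: charges give only the
  n-parameter ridge family `u_S = w(Σ_{i∈S} aᵢ)` of weights — the open weight set of `TiltAgreementAt` must come from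
  radii/inner rings (η-squeeze) — R5' stays crux-adjacent.
* R6: `…TransferRigidity` p118827 (equal 1- and 2-disc counts ⇒ all pattern counts, Regular configs) and the ROUTE-GAP
  THEOREM `…RegularNotRigid` p120899: `exists_regular_patternCount_eq_not_isClose` — two `Regular` single-loop
  configurations (figure-eights C₋⁺C₊⁺ vs C₋⁺C₊⁻) with equal interiors, equal traces, equal pattern counts for every
  disc family, `cnEDist ≥ 1/3`; law-level corollary `exists_regular_laws_patternCount_eq_le_cnLawEDist`.  Hence
  statistics + `Regular` limits cannot give `d_CN`; R6 (and the sibling `TreeRigidity`'s intended proof) need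
  single-signed winding per loop + a canonical-traversal support axiom on BOTH limits.
* R4': lead analysis `work/stubs/R4-analysis.md` (the one-point data is the p.g.fl. of the angular-profile point
  process on the ridge family `w(⟨f,θ⟩)`; additivity only across scale-separated supports; tied-band loops are the
  structural obstruction; exact-eigenvector reading; u = 0 endpoint).

## Wave 3 (seat c2-0, 2026-08-16T19:30–21:10Z) — R2' reduced to (QU); first-moment identity

* R2': `…StaircasePathwise` p121746, `…StaircaseGapTowers` p121909 (a gap-crossing loop empties the tower; gap towers
  exact), `…StaircaseReduction` p122218: `stub_staircaseDecoupling_of_inputs : (QU, both lattices) → R2'` with (QU)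
  RE-TYPED honestly (the wave-2 scratch form was unsatisfiable: tilted means grow with the gaps) and the design fixed
  (k = 5 equal charges, L 0 = 1, four wide gaps, `w_j ≥ 1` at every gap).
* R1': `…FirstMomentIdentity` p122806 (on 𝕋 the untilted identity is EXACT: `∫ Θ ∂tEns.P = −t · meanTower tEns δ r`;
  both lattices: pathwise split, measurability, conjunct (i) of (L) outright), `…BondTranslation` p123470 (δℤ²-invariance
  of the law of the ℤ² loop SET; tower counts transported), `…BondReflection` p123748 (point reflections; DIPOLE SYMMETRY
  `E N_{x∖y} = E N_{y∖x}` for x + y ∈ δℤ²).  What (L) still lacks is RSW only: the tilt transfer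
  `Cov_δ(w^{N_0(r,1)}, Θ) ≤ C·E[w^N]`, the tilted Σθ² bound, and on ℤ² the O(1) untilted centring (medial-cell bridge).

## Lead reshape r6 (seat c3-0, sixth lead, after wave 1 — 2026-08-16T22Z; 18 modules landed)

Registered by `skeleton check` (this seat is the only live lead): R1' `stub_uvDecoupling`, R2' `stub_staircaseDecoupling`,
R4'' `stub_oneDiscTilt` (lead), R5'' `stub_fusionLaw` (lead), R6 `stub_transfer`; keystone helper stubs K1–K3 registered by
`stub-add` and LANDED in wave 1.
* KEYSTONES (both lattices): K3 smeared EXACT centring on bond-ℤ² at p = 1/2 (`smearedCentring_zEns`, …SmearedCentringZ2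
  p125716 + …Cells p125322 (medial cell bridge) + …Dipole p125381 (self-duality is measure-preserving; cross-class dipoles)) —
  so the untilted first-moment identity of (L) is EXACT on BOTH lattices; K1 first moment of big-loop counts at all scales above
  the mesh (`integral_ncard_bigLoops_le`, …BigLoopsFirstMoment p125372: ℤ² local tops, 𝕋 BK/RSW per covering disc); K2 two-arm
  decay of the EXPECTED NUMBER of loops meeting `closedBall x a` and leaving `ball x b` — the registered form with `a < b` was
  FALSE (tEns, a = 1, b = 1 + δ/100: hexagon loops of isolated sites near the circle, E[#] ≳ 1/δ; registration expired) and the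
  corrected `4 * a ≤ b` form is LANDED (`integral_ncard_loops_cross_le_of_four_mul_le`, …LoopCrossCount p126008 + …LoopCrossCountT
  p125517 (tails ⇒ expectation, 𝕋 half) + …LoopCrossCountZ2Clusters p125852 (many loops ⇒ disjoint crossings on ℤ² without planar
  topology: loop ↦ rim cluster is injective)).
* R1': reduced FURTHER to the three explicit hypotheses of `uvDecoupling_of_collar_bounds` (…UVTiltTransferReduction p126379):
  (HK) untilted `∫ K ≤ C` and tilted `∫ w^N K ≤ C·towerMoment` for the COLLAR statistic K (inner-collar disc fractions of loops
  meeting `closedBall 0 r` not inside `ball 0 (r−2δ)` + exit loops + outer-collar ring fractions), (H2) untilted `∫ Σ_{∉ tower} θ² ≤ C`,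
  (U) tilted exponential concentration; landed: exact far/boundary split with the far family independent of the tower
  (…UVTiltTransfer p125364), `|Θ_B| ≤ |t|·K` pathwise with `φ_u ≤ diam²/r²`, `ψ_u ≤ diam²/3` (…UVTiltTransferCollar p126003),
  `∫Θ = −t·meanTower` EXACT on BOTH lattices + integrabilities (…UVTiltTransferInputs p126196).  The untilted halves of (HK),(H2)
  are dyadic sums of K1/K2 (wave 2); the tilted half of (HK) and (U) are the genuine tilted RSW content (window change of the
  tower moment + "an extra interface arm under the w^N-tilt costs λ^{-c}").
* R2': (QU) mapped conjunct by conjunct (work/stubs/QU-map.md of the R2' worker): 4 integrabilities LANDED (…StaircaseIntegrability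
  p125268), `∫ g_tot = towerMoment · ∏_j E[w_j^{N_j}]` EXACT (…StaircaseTowerProduct p125541), `(1 − Σ_j C (M_j/L_{j+1})^c) ∫g_tot ≤ J ≤ ∫g_tot`
  (…StaircaseGoodEvent p126015), `∫Θ = −t·m − Σ_j θ_j E N_j` EXACT on both lattices (…StaircaseFirstMoment p126234, via K3); units of
  (cmp)/(Q) re-checked and PASS; (QU) remains open in five NAMED tilted-RSW statements: `Staircase.tilted_drift_bound` (shared with
  R1'), `Staircase.gapTower_expMoment_bound` (uniform-in-mesh exponential moments of the nested-loop count of a fixed annulus —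
  registered as keystone K5 `towerCount_expMoment_bound` for wave 2), `Staircase.tilted_sqPhase_bound`, `Staircase.tilted_exp_concentration`
  (gap-uniform constant), `Staircase.signed_part_le`.
* R5' → `stub-misstated` ⇒ RE-CUT.  At a fixed disc family every transform identity (any density, rings, radii) puts the exact weights
  on the RIDGE `u₁₂ = w(w⁻¹u₁ + w⁻¹u₂)` — LANDED as the symmetric sextic `magicWeight_ridge_sextic` with the witness
  `ridge_tilt_eq_of_two_laws` (two count LAWS on ℕ³ with equal tilts on the whole ridge: …FusionRidge p125759); the η-squeeze is LANDED
  (…FusionSqueeze p125481: hugging loops `≤ C η^c` on both lattices, tied loops, gate discs, `|tilt − tilt| ≤ gates`) but only makes tied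
  weights invisible, it does not thicken the ridge; and hypothesis 3 already IS one-disc LAW agreement (landed peeling).  So the OPEN
  weight set of `TiltAgreementAt` cannot come from identities: the n ≥ 2 layer is re-cut as **R5'' `stub_fusionLaw`** (same hypotheses,
  `2 ≤ n`, conclusion `LawAgreementAt n z r R`) composed through the new glue `nestingStatisticsAgree_of_lawAgreement_two` (n = 0 trivial,
  n = 1 landed, n ≥ 2 the stub); `fusion_of_tiltAgreement'`, `stub_pgfUniqueness` and S4b `stub_tiltUniqueness` leave the composition,
  and R4' drops its now-unused centred-tower conjunct: **R4'' `stub_oneDiscTilt`** (cloud laws + calibrated pressures + densities ⇒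
  all-window one-disc tilt agreement).  R4''/R5'' are the crux's content (identities ⇒ LAWS: one-point, resp. sibling identification =
  first-generation kernel agreement, the markov-cascade mechanism) and are HELD BY THE LEAD, not delegated.
* R6: blocked on a NAMED fact at last — Aizenman–Burchard, Duke Math. J. 99 (1999), Thm 1.2 + Thm A.1 (ℤ²-side precompactness;
  DKKMO arXiv:2012.11672 prints no (C, d_CN) tightness; Camia–Newman CMP 268 only invoke A–B on 𝕋) — grounding report
  work/stubs/TransferPrecompact.md (candidate `def`, four not-verbatim gaps); LANDED the first brick of the repaired reconstruction:
  `simpleLoop_udist_eq_zero_of_range_eq` (…TransferSimpleLoops p125567: simple loops with equal trace are equal mod reversal, full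
  strength).  Still open behind A–B: regularity/support of subsequential limits and reconstruction for non-simple non-crossing loops
  (canonical traversal; planner-level statement).

## Disproof used (`Cruxes/NestingRigidity/Disproof.lean` v1.3 + barrier `NestingTransformBlindness` p68977)

No `_false_without_` theorem exists for this crux.  (i)–(iii) type / null-interior / covering blindness:
no stub reads types, fatness or degree off a transform (R6 takes them from the lattice); (iv)+§5 the
conditional CLE₃⊔CLE₃ impostor passes R1–R3 verbatim (calibration only: `2e₃ = e₆`,
`sswMGF_three_eq_six`) and is the declared test case of R4, whose hypotheses are the two LATTICE ensembles
(single interface-Markov tower), not "a law with the CLE₆ transform".  Targets §(v1.3) concern the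
markov-cascade line; none names a stub below.
-/

noncomputable section

open MeasureTheory Set Filter Metric
open scoped Real Topology BigOperators

namespace Summit.CriticalPhenomena.CardyFormulaZ2.Cruxes.NestingRigidity.RingCloudTomography

open Literature.Probability.RandomPlanarGeometry Literature.Probability.Percolation
  Literature.Probability.LatticeModels
open _root_.Summit.CriticalPhenomena.CardyFormulaZ2.Theses.CardyMagicRigidity
  (MagicFormulaZ2 MagicFormulaT LoopLimitZ2EqT NestingRigidity)
open Summit.CriticalPhenomena.CardyFormulaZ2.Cruxes.NestingRigidity.PositiveConeWeightDoubling
  (magicWeight beta nuSix meanTower ConeTiltLaw NestingDensity magicWeight_doubling exponent_gap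
    density_from_doubling calibrated_exponent_eq_magicExponent_six UVDecoupling coneTiltLaw_of_cloudLaw
    TiltAgreementAt LawAgreementAt Precompactness Regular)

/-! ## §0 Landed inputs (imported): S1a, S1b, S4b -/

example : CloudAdmissibility := stub_cloudAdmissibility
example : CloudEnergy := stub_cloudEnergy
example : CloudCalculus := cloudCalculus_of stub_cloudAdmissibility stub_cloudEnergy

/-! ## §1 The partner sandwich (inline statement; same shape as `ConeTiltLaw`, partner charge range) -/

/-- **Partner tilt law** of an ensemble: for every PARTNER charge `t' ∈ (−5π/6, −π/2)` (the image of the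
cone `(−π/6, π/6)` under the weight-preserving involution `t ↦ −2π/3 − t`) and every `η > 0`, for all small
`r` and then all small meshes,
`r^{βt'²+η} ≤ E_δ[w(t')^{N_0(r,1)}] · exp(√3 t' · E_δ[N_0(r,1)]) ≤ r^{βt'²−η}`.
(For R2: realised by staircase clouds; the tower weight `w(t') ∈ (0, √3)` and the UV weights are `≥ 0`.)
Written as a predicate on `LoopEnsemble`; it is the verbatim body of `ConeTiltLaw` on the partner range. -/
def PartnerTiltLaw (E : LoopEnsemble) : Prop :=
  ∀ t ∈ Set.Ioo (-(5 * π / 6)) (-(π / 2)), ∀ η : ℝ, 0 < η → ∃ r₀ : ℝ, 0 < r₀ ∧ ∀ r ∈ Set.Ioo (0 : ℝ) r₀,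
    ∀ᶠ δ in 𝓝[>] (0 : ℝ),
      r ^ (beta * t ^ 2 + η) ≤
          E.towerMoment (magicWeight t) δ r * Real.exp (Real.sqrt 3 * t * meanTower E δ r) ∧
        E.towerMoment (magicWeight t) δ r * Real.exp (Real.sqrt 3 * t * meanTower E δ r) ≤
          r ^ (beta * t ^ 2 - η)

/-! ## §2 Glue (sorry-free) -/

/-- The route's `MagicFormulaZ2` IS the magic transform of `zEns`. -/
theorem hasMagicTransform_zEns (h : MagicFormulaZ2) : zEns.HasMagicTransform :=
  fun f R C hf hC hR h0 ↦ h f R C hf hC hR h0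

/-- Both types together of the site-`𝕋` configuration are the untyped interface loops over which
`MagicFormulaT` takes its product. -/
theorem loops_siteLoopConfig (δ : ℝ) (cfg : SiteConfig (Site 2)) :
    (siteLoopConfig δ cfg).loops =
      {u : UnbasedLoop ℂ | ∃ (v : HexVertex) (γ : hexGraph.Walk v v), IsSiteInterfaceLoop cfg γ ∧
        u = UnbasedLoop.mk (BasedLoop.mk (siteLoopCurve δ γ) (isLoop_siteLoopCurve δ γ))} := by
  ext u
  constructor
  · rintro (⟨v, γ, h, -, rfl⟩ | ⟨v, γ, h, -, rfl⟩) <;> exact ⟨v, γ, h, rfl⟩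
  · rintro ⟨v, γ, h, rfl⟩
    by_cases hs : 0 < shoelace (γ.support.map hexCenter)
    · exact Or.inr ⟨v, γ, h, ⟨fun _ ↦ hs, fun _ ↦ rfl⟩, rfl⟩
    · exact Or.inl ⟨v, γ, h, ⟨fun h0 ↦ absurd h0 (by decide), fun h' ↦ absurd h' hs⟩, rfl⟩

/-- The route's `MagicFormulaT` IS the magic transform of `tEns`. -/
theorem hasMagicTransform_tEns (h : MagicFormulaT) : tEns.HasMagicTransform := by
  intro f R C hf hC hR h0
  have key := h f R C hf hC hR h0
  have hfun : (fun δ : ℝ ↦ ∫ ω, (tEns.X δ ω).nestingWeight f ∂tEns.P) =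
      fun δ : ℝ ↦ ∫ cfg, (∏ᶠ u ∈ {u : UnbasedLoop ℂ | ∃ (v : HexVertex) (γ : hexGraph.Walk v v),
        IsSiteInterfaceLoop cfg γ ∧
          u = UnbasedLoop.mk (BasedLoop.mk (siteLoopCurve δ γ) (isLoop_siteLoopCurve δ γ))},
            2 * Real.cos ((∫ z in {z : ℂ | u.wind z ≠ 0}, f z) + Real.pi / 3))
              ∂(triSitePercolation half) := by
    funext δ
    show (∫ ω, (siteLoopConfig δ ω).nestingWeight f ∂(triSitePercolation half)) = _
    congr 1
    funext cfg
    rw [LoopConfig.nestingWeight, loops_siteLoopConfig]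
    rfl
  rw [hfun]
  exact key

/-- Cloud calculus + magic formula ⇒ cloud law. -/
theorem cloudLaw_of_hasMagicTransform (h1 : CloudCalculus) {E : LoopEnsemble}
    (hE : E.HasMagicTransform) : E.CloudLaw := by
  intro 𝔠 h𝔠
  obtain ⟨hm, ⟨C, hC⟩, ⟨R, hR⟩, h0, hQ⟩ := h1 𝔠 h𝔠
  rw [← hQ]
  exact hE _ R C hm hC hR h0

/-- Awareness check against the landed negatives (barrier `NestingTransformBlindness`). -/
example : Literature.Barriers.CriticalPhenomena.NestingTransformBlindness :=
  Literature.Barriers.CriticalPhenomena.nestingTransformBlindness_holds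

/-! ## §3 Registered stubs (the only sorries of the file) -/

/-- **R1' · UVDecoupling** (L, pure lattice RSW content, no magic formula): for both lattice ensembles the
nesting transform at the cone cloud equals the tilted tower moment times the UV drift of the SAME ensemble up
to `r^{±η}` (sibling vocabulary `UVDecoupling`, `…ConeLever` p107226).  Inputs: quasi-multiplicativity of
positively weighted tower functionals, concentration of the UV drift, first-moment identity. -/
theorem stub_uvDecoupling : ∀ E ∈ latticeEnsembles, UVDecoupling E := by
  sorry

/-- R1 (old `stub_coneTilt`) from R1' and the sibling glue `coneTiltLaw_of_cloudLaw`. -/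
theorem coneTilt_of_uvDecoupling (hUV : ∀ E ∈ latticeEnsembles, UVDecoupling E) :
    ∀ E ∈ latticeEnsembles, E.CloudLaw → ConeTiltLaw E :=
  fun E hE hc ↦ coneTiltLaw_of_cloudLaw hc (hUV E hE)

/-- **R2' · StaircaseDecoupling** (L, pure lattice RSW content): for both lattice ensembles and every partner
charge there is a STAIRCASE (number of rings, radii `1 ≤ L j < M j`, separated) whose nesting transform equals
the tilted tower moment times the UV drift up to `r^{±η}` — the hypothesis of the landed
`Staircase.partnerTilt_of_decoupling` (p110700) verbatim.  Inputs: the landed bite classification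
(`Staircase.nestingFactor_nonneg_or_cross`), polychromatic gap-crossing bounds for the annuli `A(M j, L (j+1))`,
quasi-multiplicativity, UV-drift concentration. -/
theorem stub_staircaseDecoupling : ∀ E ∈ latticeEnsembles,
    ∀ t ∈ Set.Ioo (-(5 * π / 6)) (-(π / 2)), ∀ η : ℝ, 0 < η →
      ∃ (k : ℕ) (L M : Fin k → ℝ) (r₀ : ℝ), 0 < k ∧ (∀ j, 0 < L j) ∧ (∀ j, L j < M j) ∧
        (∀ j l, j < l → M j ≤ L l) ∧ 0 < r₀ ∧ (∀ j, r₀ ≤ L j) ∧ ∀ r ∈ Set.Ioo (0 : ℝ) r₀,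
          ∀ᶠ δ in 𝓝[>] (0 : ℝ),
            r ^ η * (E.towerMoment (magicWeight t) δ r * Real.exp (Real.sqrt 3 * t * meanTower E δ r)) ≤
                ∫ ω, (E.X δ ω).nestingWeight (Cloud.mk 1 k (fun _ ↦ 0) (fun _ ↦ r) (fun _ ↦ t)
                  (fun _ ↦ 0) L M (fun _ ↦ -t / k)).density ∂E.P ∧
              ∫ ω, (E.X δ ω).nestingWeight (Cloud.mk 1 k (fun _ ↦ 0) (fun _ ↦ r) (fun _ ↦ t)
                  (fun _ ↦ 0) L M (fun _ ↦ -t / k)).density ∂E.P ≤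
                r ^ (-η) * (E.towerMoment (magicWeight t) δ r * Real.exp (Real.sqrt 3 * t * meanTower E δ r)) := by
  sorry

/-- R2 (old `stub_partnerTilt`, i.e. `PartnerTiltLaw E`) from R2' and the landed staircase glue. -/
theorem partnerTilt_of_staircaseDecoupling
    (hS : ∀ E ∈ latticeEnsembles,
    ∀ t ∈ Set.Ioo (-(5 * π / 6)) (-(π / 2)), ∀ η : ℝ, 0 < η →
      ∃ (k : ℕ) (L M : Fin k → ℝ) (r₀ : ℝ), 0 < k ∧ (∀ j, 0 < L j) ∧ (∀ j, L j < M j) ∧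
        (∀ j l, j < l → M j ≤ L l) ∧ 0 < r₀ ∧ (∀ j, r₀ ≤ L j) ∧ ∀ r ∈ Set.Ioo (0 : ℝ) r₀,
          ∀ᶠ δ in 𝓝[>] (0 : ℝ),
            r ^ η * (E.towerMoment (magicWeight t) δ r * Real.exp (Real.sqrt 3 * t * meanTower E δ r)) ≤
                ∫ ω, (E.X δ ω).nestingWeight (Cloud.mk 1 k (fun _ ↦ 0) (fun _ ↦ r) (fun _ ↦ t)
                  (fun _ ↦ 0) L M (fun _ ↦ -t / k)).density ∂E.P ∧
              ∫ ω, (E.X δ ω).nestingWeight (Cloud.mk 1 k (fun _ ↦ 0) (fun _ ↦ r) (fun _ ↦ t)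
                  (fun _ ↦ 0) L M (fun _ ↦ -t / k)).density ∂E.P ≤
                r ^ (-η) * (E.towerMoment (magicWeight t) δ r * Real.exp (Real.sqrt 3 * t * meanTower E δ r))) :
    ∀ E ∈ latticeEnsembles, E.CloudLaw → PartnerTiltLaw E :=
  fun E hE hc ↦ Staircase.partnerTilt_of_decoupling hc (hS E hE)

/-- **R3 · PressureCalibration** — LANDED (p106959, `…PressureCalibration`, imported): the cone law and the
partner law of a lattice ensemble force `NestingDensity E` and `E.HasTowerPressure e6 (Ioo 0 √3)`. -/
example : ∀ E ∈ latticeEnsembles, ConeTiltLaw E → PartnerTiltLaw E →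
    NestingDensity E ∧ E.HasTowerPressure e6 (Set.Ioo 0 (Real.sqrt 3)) :=
  stub_pressureCalibration

/-- **R4'' · OneDiscTilt** (XL, LOAD-BEARING, lead; the research content, one-point layer). Both cloud laws, both
calibrated pressures and both nesting densities force the positively TILTED one-disc laws of the two lattices to merge, at
EVERY window: `E[u^{patternCount ![z₀] ![r₀] R {0}}]` on bond-`ℤ²` and on site-`𝕋` differ by `o(1)` for every disc
`B̄(z₀,r₀) ⊆ B(0,R)` and `u ∈ (0,1)` (the n = 1 layer of `NestingStatisticsAgree` by the landed peeling
`nestingStatisticsAgree_one_of_oneDiscTilt`; `TowerStatisticsAgree` is not needed any more, r6).  Identities ⇒ LAWS: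
non-crossing chain + lattice interface-Markov single tower + electric rank one; "no dark modes" must be DERIVED (CLE₃⊔CLE₃
is the test); value-level, not exponent-level (the n = 1 pressures are R3): see the lead's analysis `R4-analysis-c3.md`. -/
theorem stub_oneDiscTilt :
    zEns.CloudLaw → tEns.CloudLaw →
      zEns.HasTowerPressure e6 (Ioo 0 (Real.sqrt 3)) → tEns.HasTowerPressure e6 (Ioo 0 (Real.sqrt 3)) →
        NestingDensity zEns → NestingDensity tEns →
        ∀ (z₀ : ℂ) (r₀ R u : ℝ), 0 < r₀ → closedBall z₀ r₀ ⊆ ball 0 R → 0 < u → u < 1 →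
          Tendsto (fun δ : ℝ ↦ (∫ ω, u ^ patternCount (zEns.X δ ω) ![z₀] ![r₀] R {0} ∂zEns.P) -
            ∫ ω, u ^ patternCount (tEns.X δ ω) ![z₀] ![r₀] R {0} ∂tEns.P) (𝓝[>] 0) (𝓝 0) := by
  sorry

/-- **R5'' · FusionLaw** (XL, crux content, lead; the sibling-identification layer, r6 re-cut of R5'). Both cloud
laws and the all-window one-disc tilt agreement force LAW agreement of the pattern-count vector at every admissible family
of `n ≥ 2` pairwise disjoint discs.  Why re-cut (worker R5', wave 1): every transform identity at a fixed family puts the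
weights on the ridge `u_S = w(Σ_{i∈S} aᵢ)` (landed sextic `magicWeight_ridge_sextic`; two count laws with equal tilts on the
whole ridge exist, `ridge_tilt_eq_of_two_laws`), the η-squeeze (landed, `measure_exists_huggingLoop_le_latticeEnsembles`) only
hides tied weights, and hypothesis 3 already is one-disc LAW agreement — so no OPEN weight set (`TiltAgreementAt`) can come out
of identities; the intended mechanism is the Markov cascade (agreement of first-generation kernels in domains + the lattice
domain-Markov property, sibling line `markov-cascade-one-generation`), i.e. crux-level.  Analysis: work/stubs/R5-c3-analysis.md. -/
theorem stub_fusionLaw :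
    zEns.CloudLaw → tEns.CloudLaw →
      (∀ (z₀ : ℂ) (r₀ R u : ℝ), 0 < r₀ → closedBall z₀ r₀ ⊆ ball 0 R → 0 < u → u < 1 →
        Tendsto (fun δ : ℝ ↦ (∫ ω, u ^ patternCount (zEns.X δ ω) ![z₀] ![r₀] R {0} ∂zEns.P) -
          ∫ ω, u ^ patternCount (tEns.X δ ω) ![z₀] ![r₀] R {0} ∂tEns.P) (𝓝[>] 0) (𝓝 0)) →
      ∀ (n : ℕ) (z : Fin n → ℂ) (r : Fin n → ℝ) (R : ℝ), 2 ≤ n → (∀ i, 0 < r i) →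
        (∀ i j, i ≠ j → r i + r j < ‖z i - z j‖) → LawAgreementAt n z r R := by
  sorry

/-- **Glue (r6): one-disc tilts + sibling law agreement ⇒ `NestingStatisticsAgree`** — n = 0 is trivial (the event is `univ`
on both sides), n = 1 is the landed peeling `nestingStatisticsAgree_one_of_oneDiscTilt` (p111833), n ≥ 2 is R5''. -/
theorem nestingStatisticsAgree_of_lawAgreement_two
    (h1 : ∀ (z₀ : ℂ) (r₀ R u : ℝ), 0 < r₀ → closedBall z₀ r₀ ⊆ ball 0 R → 0 < u → u < 1 →
        Tendsto (fun δ : ℝ ↦ (∫ ω, u ^ patternCount (zEns.X δ ω) ![z₀] ![r₀] R {0} ∂zEns.P) -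
          ∫ ω, u ^ patternCount (tEns.X δ ω) ![z₀] ![r₀] R {0} ∂tEns.P) (𝓝[>] 0) (𝓝 0))
    (h2 : ∀ (n : ℕ) (z : Fin n → ℂ) (r : Fin n → ℝ) (R : ℝ), 2 ≤ n → (∀ i, 0 < r i) →
        (∀ i j, i ≠ j → r i + r j < ‖z i - z j‖) → LawAgreementAt n z r R) :
    NestingStatisticsAgree := by
  intro n z r R k hr hsep
  rcases Nat.lt_or_ge n 2 with hn | hn
  · interval_cases n
    · haveI : IsProbabilityMeasure zEns.P := isProbabilityMeasure_of_mem zEns_mem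
      haveI : IsProbabilityMeasure tEns.P := isProbabilityMeasure_of_mem tEns_mem
      have h0 : ∀ (E : LoopEnsemble) (δ : ℝ), {ω : E.Ω | ∀ S : Finset (Fin 0), S.Nonempty →
          patternCount (E.X δ ω) z r R S = k S} = Set.univ := fun E δ ↦
        Set.eq_univ_of_forall fun ω S hS ↦ absurd hS (by simp [Finset.eq_empty_of_isEmpty S])
      simp only [h0, measure_univ, ENNReal.toReal_one, sub_self]
      exact tendsto_const_nhds
    · exact nestingStatisticsAgree_one_of_oneDiscTilt h1 z r R k hr
  · exact h2 n z r R hn hr hsep k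

/-- **R6 · Transfer** (L–XL): `NestingStatisticsAgree → LoopLimitZ2EqT`. -/
theorem stub_transfer : Transfer := by
  sorry

/-! ## §4 The composition: R1 → ⋯ → R6 → crux -/

/-- Local alias of the crux `NestingRigidity` (so that `NestingRigidity_of` below is the ONLY theorem of
the file concluding the crux by name, as the skeleton audit requires). -/
def CruxStatement : Prop := NestingRigidity

/-- **The reduction, sorry-free** (r6): cloud calculus (S1) turns both magic formulas into cloud laws; UV
decoupling (R1') gives the cone laws and staircase decoupling (R2') the partner laws (landed glues); R3 (landed)
calibrates density and pressure on BOTH lattices; R4'' gives the all-window one-disc tilt agreement; R5'' the sibling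
law agreement at every disc family with `n ≥ 2`; the r6 glue assembles `NestingStatisticsAgree`; R6 transfers to
`LoopLimitZ2EqT`. -/
theorem nestingRigidity_of_stubs (h1a : CloudAdmissibility) (h1b : CloudEnergy)
    (hR1 : ∀ E ∈ latticeEnsembles, UVDecoupling E)
    (hR2 : ∀ E ∈ latticeEnsembles,
    ∀ t ∈ Set.Ioo (-(5 * π / 6)) (-(π / 2)), ∀ η : ℝ, 0 < η →
      ∃ (k : ℕ) (L M : Fin k → ℝ) (r₀ : ℝ), 0 < k ∧ (∀ j, 0 < L j) ∧ (∀ j, L j < M j) ∧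
        (∀ j l, j < l → M j ≤ L l) ∧ 0 < r₀ ∧ (∀ j, r₀ ≤ L j) ∧ ∀ r ∈ Set.Ioo (0 : ℝ) r₀,
          ∀ᶠ δ in 𝓝[>] (0 : ℝ),
            r ^ η * (E.towerMoment (magicWeight t) δ r * Real.exp (Real.sqrt 3 * t * meanTower E δ r)) ≤
                ∫ ω, (E.X δ ω).nestingWeight (Cloud.mk 1 k (fun _ ↦ 0) (fun _ ↦ r) (fun _ ↦ t)
                  (fun _ ↦ 0) L M (fun _ ↦ -t / k)).density ∂E.P ∧
              ∫ ω, (E.X δ ω).nestingWeight (Cloud.mk 1 k (fun _ ↦ 0) (fun _ ↦ r) (fun _ ↦ t)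
                  (fun _ ↦ 0) L M (fun _ ↦ -t / k)).density ∂E.P ≤
                r ^ (-η) * (E.towerMoment (magicWeight t) δ r * Real.exp (Real.sqrt 3 * t * meanTower E δ r)))
    (hR3 : ∀ E ∈ latticeEnsembles, ConeTiltLaw E → PartnerTiltLaw E →
      NestingDensity E ∧ E.HasTowerPressure e6 (Ioo 0 (Real.sqrt 3)))
    (hR4 : zEns.CloudLaw → tEns.CloudLaw →
      zEns.HasTowerPressure e6 (Ioo 0 (Real.sqrt 3)) → tEns.HasTowerPressure e6 (Ioo 0 (Real.sqrt 3)) →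
        NestingDensity zEns → NestingDensity tEns →
        ∀ (z₀ : ℂ) (r₀ R u : ℝ), 0 < r₀ → closedBall z₀ r₀ ⊆ ball 0 R → 0 < u → u < 1 →
          Tendsto (fun δ : ℝ ↦ (∫ ω, u ^ patternCount (zEns.X δ ω) ![z₀] ![r₀] R {0} ∂zEns.P) -
            ∫ ω, u ^ patternCount (tEns.X δ ω) ![z₀] ![r₀] R {0} ∂tEns.P) (𝓝[>] 0) (𝓝 0))
    (hR5 : zEns.CloudLaw → tEns.CloudLaw →
      (∀ (z₀ : ℂ) (r₀ R u : ℝ), 0 < r₀ → closedBall z₀ r₀ ⊆ ball 0 R → 0 < u → u < 1 →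
        Tendsto (fun δ : ℝ ↦ (∫ ω, u ^ patternCount (zEns.X δ ω) ![z₀] ![r₀] R {0} ∂zEns.P) -
          ∫ ω, u ^ patternCount (tEns.X δ ω) ![z₀] ![r₀] R {0} ∂tEns.P) (𝓝[>] 0) (𝓝 0)) →
      ∀ (n : ℕ) (z : Fin n → ℂ) (r : Fin n → ℝ) (R : ℝ), 2 ≤ n → (∀ i, 0 < r i) →
        (∀ i j, i ≠ j → r i + r j < ‖z i - z j‖) → LawAgreementAt n z r R)
    (h6 : Transfer) : CruxStatement := by
  show NestingRigidity
  intro hZ hT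
  have h1 : CloudCalculus := cloudCalculus_of h1a h1b
  have cZ : zEns.CloudLaw := cloudLaw_of_hasMagicTransform h1 (hasMagicTransform_zEns hZ)
  have cT : tEns.CloudLaw := cloudLaw_of_hasMagicTransform h1 (hasMagicTransform_tEns hT)
  have coneZ : ConeTiltLaw zEns := coneTiltLaw_of_cloudLaw cZ (hR1 zEns zEns_mem)
  have coneT : ConeTiltLaw tEns := coneTiltLaw_of_cloudLaw cT (hR1 tEns tEns_mem)
  have partZ : PartnerTiltLaw zEns := Staircase.partnerTilt_of_decoupling cZ (hR2 zEns zEns_mem)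
  have partT : PartnerTiltLaw tEns := Staircase.partnerTilt_of_decoupling cT (hR2 tEns tEns_mem)
  obtain ⟨dZ, pZ⟩ := hR3 zEns zEns_mem coneZ partZ
  obtain ⟨dT, pT⟩ := hR3 tEns tEns_mem coneT partT
  have honeDisc := hR4 cZ cT pZ pT dZ dT
  have hNS : NestingStatisticsAgree := nestingStatisticsAgree_of_lawAgreement_two honeDisc (hR5 cZ cT honeDisc)
  exact h6 hNS

/-- **Ring-cloud tomography closes `NestingRigidity`** — the skeleton theorem (r6): concludes the crux BY
NAME from the registered stubs (S1a/S1b/R3 and the glues imported and proved; the only sorries sit inside R1',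
R2', R4'', R5'', R6). -/
theorem NestingRigidity_of : NestingRigidity :=
  nestingRigidity_of_stubs stub_cloudAdmissibility stub_cloudEnergy stub_uvDecoupling
    stub_staircaseDecoupling stub_pressureCalibration stub_oneDiscTilt stub_fusionLaw stub_transfer

/-! ## §5 Sanity of the new statement shapes (sorry-free checks) -/

/-- The partner range is the image of the cone under the weight-preserving involution. -/
example {t : ℝ} (ht : t ∈ Set.Ioo (-(π / 6)) (π / 6)) : -t - 2 * π / 3 ∈ Set.Ioo (-(5 * π / 6)) (-(π / 2)) := by
  constructor <;> linarith [ht.1, ht.2]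

/-- Same tower weight at the partner charge. -/
example (t : ℝ) : magicWeight (-t - 2 * π / 3) = magicWeight t := magicWeight_doubling t

/-- The old n = 1 statements follow: with the cone and partner laws of a lattice ensemble in hand, the landed R3
gives the `TowerPressureFamily`-type existence with `a = 1/2π` (`e6_eq_pressureFamily`) on the open range. -/
example {E : LoopEnsemble} (hE : E ∈ latticeEnsembles) (hc : ConeTiltLaw E) (hp : PartnerTiltLaw E) :
    ∃ a : ℝ, E.HasTowerPressure (pressureFamily a) (Ioo 0 (Real.sqrt 3)) := by
  refine ⟨1 / (2 * π), ?_⟩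
  rw [← e6_eq_pressureFamily]
  exact (stub_pressureCalibration E hE hc hp).2

/-- The landed R6 glue: `Transfer` follows from the sibling stub `Precompactness` and a statistics-form tree
rigidity along doubly convergent regular subsequences (`transfer_of_precompactness`, p112841) — recorded, not
used by `NestingRigidity_of` (R6 is kept whole: see the ROUTE GAP in the module docstring). -/
example : Precompactness →
    (∀ (δs : ℕ → ℝ) (X X' : unitInterval → LoopConfig ℂ), Tendsto δs atTop (𝓝[>] (0 : ℝ)) →
      Tendsto (fun k : ℕ ↦ LoopConfig.cnLawEDist zEns.P (zEns.X (δs k)) volume X) atTop (𝓝 0) →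
      Tendsto (fun k : ℕ ↦ LoopConfig.cnLawEDist tEns.P (tEns.X (δs k)) volume X') atTop (𝓝 0) →
      (∀ᵐ s : unitInterval, Regular (X s)) → (∀ᵐ s : unitInterval, Regular (X' s)) →
      NestingStatisticsAgree →
        Tendsto (fun k : ℕ ↦ LoopConfig.cnLawEDist zEns.P (zEns.X (δs k)) tEns.P (tEns.X (δs k)))
          atTop (𝓝 0)) →
    Transfer :=
  transfer_of_precompactness

/-- Wave-2 glue (landed p116917): R1' reduces to the two RSW statements (L), (U) of
`uvDecoupling_of_tilted_moments` — recorded by re-deriving `UVDecoupling` from them. -/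
example := @uvDecoupling_of_tilted_moments

/-- Wave-2 route-gap theorem (landed p120899): `Regular` + equal pattern statistics do not force `d_CN`-closeness. -/
example := @exists_regular_patternCount_eq_not_isClose

/-- Wave-3 glue (landed p122218): R2' reduces to the RSW statement (QU) of `stub_staircaseDecoupling_of_inputs`. -/
example := @stub_staircaseDecoupling_of_inputs

/-- S4b `stub_tiltUniqueness` (p75974) stays landed but leaves the composition in r6 (centred towers are no longer used). -/
example := @stub_tiltUniqueness

/-- Seat c3-0 wave 1 (landed p126379): R1' reduces to the collar bounds (HK), (H2), (U) of `uvDecoupling_of_collar_bounds`. -/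
example := @uvDecoupling_of_collar_bounds

/-- Seat c3-0 wave 1 (landed p125541, p126015, p126234): (QU)'s main term factorises exactly, the good event costs a
`(1 − Σ_j C (M_j/L_{j+1})^c)` factor, and the rest phase has an EXACT mean on both lattices. -/
example := @staircase_integral_gtot_eq_prod
example := @staircase_integral_gtot_good_ge
example := @staircase_integral_restPhase_latticeEnsembles

/-- Seat c3-0 wave 1 keystones (landed p125716, p125372, p126008): exact centring on `ℤ²`, big-loop first moments, two-arm
decay of loop counts in expectation (aspect ratio 4). -/
example := @smearedCentring_zEns
example := @integral_ncard_bigLoops_le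
example := @integral_ncard_loops_cross_le_of_four_mul_le

/-- Seat c3-0 wave 1, the n ≥ 2 re-cut (landed p125759, p125481): identities see only the ridge; the squeeze hides tied weights. -/
example := @magicWeight_ridge_sextic
example := @ridge_tilt_eq_of_two_laws
example := @measure_exists_huggingLoop_le_latticeEnsembles

/-- Seat c3-0 wave 1, transfer layer (landed p125567): simple loops with equal trace coincide mod reversal. -/
example := @simpleLoop_udist_eq_zero_of_range_eq


end Summit.CriticalPhenomena.CardyFormulaZ2.Cruxes.NestingRigidity.RingCloudTomography

end
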